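import Literature.Computability.AlgebraicComplexity.PrattPackingTransfer
import Literature.Computability.AlgebraicComplexity.PrattTrapezoidValSTPP
import Literature.Barriers.MatrixMultiplication.TricoloredSumFreeBarrierProofs
import HarnessLib

/-!
# Pratt 2024, Theorem 4.4 proved: `ω = 2` via STPPs in `(ℤ/q)^ℓ` forces `Val(ℤ/nℤ) ≥ K n^{1+c}`

K. Pratt, *On generalized corners and matrix multiplication*, ITCS 2024 = arXiv:2309.03878
[Pratt2024], Thm. 4.4 with its proof (held text, p. 9). This file discharges the named fact
`pratt2024_thm44` of `PrattPackingTransfer.lean`: `pratt2024_thm44_holds`. Everything is proved.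
(The sibling `PrattPackingTransferProofs.lean` treats the other fact of that file, Cor. 2.10:
`not_pratt2024_cor210` and the corrected sum-of-minima statement for primes; it is not used here.)

## The printed proof and the one road not taken from it

Print (p. 9): (1) "By Cor. 2.10 … `Σ|Xᵢ||Yᵢ| ≤ (q/C)^ℓ` … By Hölder's inequality,
`Σ (|Xᵢ||Yᵢ||Zᵢ|)^{2/3} ≤ (q/C^{1/3})^ℓ`"; (2) "If we can obtain `ω < 3 − α` via (prop:stppbound),
then `q^ℓ < Σ (…)^{2α/3+(1−α)} ≤ (Σ (…)^{2/3})^α (Σ |Xᵢ||Yᵢ||Zᵢ|)^{1−α}`", so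
`Σ|Xᵢ||Yᵢ||Zᵢ| > q^ℓ (C^{α/3(1−α)})^ℓ`, "> `q^ℓ 4^ℓ`" for `α` near `1`; (3) `k`-fold products of the
STPP; (4) the mixed-radix embedding `ℤ_q^N ↪ ℤ_{(3q)^N}` reflecting three-fold sums, whence
`Val(ℤ_{(3q)^N}) > (4q)^N` (Prop. 3.3); (5) Prop. 4.3 (3) for the remaining `n`.

Step (1) cannot be followed: Cor. 2.10 is false as printed (three-block counterexample,
`Literature.Combinatorics.Additive.not_Pratt2024_cor210`, `TightTriangleRemovalProofs.lean`, and
for the statement file's own rendering `not_pratt2024_cor210`, `PrattPackingTransferProofs.lean`).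
Its OUTPUT, the `2/3`-moment bound, is nevertheless true, with `C^{1/3} = e^{δ}`,
`δ = log((2/3)2^{2/3})`: it is what the proof of Blasiak–Church–Cohn–Grochow–Naslund–Sawin–Umans
2017, Thm. B (§3.2: Thm. 3.3, Lemma 3.4, Lemma 3.5, tensor powers) yields when fed Thm. A′ (the
explicit tricolored sum-free bound `3|H|^{1−δ/log q}` for `H ≅ (ℤ/q)ⁿ`, PROVED in the tree:
`BCCGNSU2017_thmA'_holds`) instead of the qualitative Thm. A; the tree's proof of Thm. B
(`GroupTheoreticMatMulThmBProofs.lean`) is reused verbatim up to that input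
(`AddSimultaneousTPP.sum_rpow_two_thirds_le_pow`). Steps (2)–(4) are as printed
(`α = 33/34`, using `e^{33δ} > 3`; `AddSimultaneousTPP.pi`; the tree's mixed-radix transport
`sum_card_mul_le_prattVal_zmod_of_reflect`, which includes Prop. 3.3), and (5) is replaced by the
remark that the transport works for every modulus `n ≥ (3q)^{kℓ}`, so the largest `k` with
`(3q)^{kℓ} ≤ n` serves `n` directly (`exists_const_rpow_le_prattVal`; Prop. 4.3 is not needed).

## References

* [Pratt2024] K. Pratt, arXiv:2309.03878 = ITCS 2024 (LIPIcs 287:89): Thm. 4.4 and its proof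
  (p. 9), Cor. 2.10 (p. 6), Prop. 3.3 (p. 7).
* [BlasiakChurchCohnGrochowNaslundSawinUmans2017] Discrete Analysis 2017:3: Thm. A′, §3.2
  (Thm. 3.3, Lemmas 3.4–3.5), the source of the `2/3`-moment bound used here.
-/

noncomputable section

open scoped BigOperators
open Finset

namespace Literature.Computability.AlgebraicComplexity

open Literature.Combinatorics.Additive (AddSimultaneousTPP IsTricoloredSumFree)
open Literature.Barriers.MatrixMultiplication (bccgnsuDelta bccgnsuDelta_pos BCCGNSU2017_thmA'
  BCCGNSU2017_thmA'_holds)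
open Literature.Computability.AlgebraicComplexity.Combinatorics (wordType prod_eq_prod_pow_wordType
  le_of_pow_le_poly_mul_pow)

/-! ### Flattening: powers and products of `(ℤ/q)^ℓ` are again of the form `(ℤ/q)^n` -/

section Flatten

variable (M : Type*) [AddCommMonoid M]

/-- `(Fin a → Fin b → M) ≃+ (Fin (ab) → M)` (uncurry and enumerate `Fin a × Fin b`). [folklore] -/
theorem nonempty_addEquiv_fun_fun (a b : ℕ) :
    Nonempty ((Fin a → Fin b → M) ≃+ (Fin (a * b) → M)) :=
  ⟨((LinearEquiv.curry ℕ M (Fin a) (Fin b)).symm ≪≫ₗ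
      LinearEquiv.funCongrLeft ℕ M finProdFinEquiv.symm).toAddEquiv⟩

/-- `(Fin a → M) × (Fin b → M) ≃+ (Fin (a + b) → M)`. [folklore] -/
theorem nonempty_addEquiv_fun_prod_fun (a b : ℕ) :
    Nonempty (((Fin a → M) × (Fin b → M)) ≃+ (Fin (a + b) → M)) :=
  ⟨((LinearEquiv.sumArrowLequivProdArrow (Fin a) (Fin b) ℕ M).symm ≪≫ₗ
      LinearEquiv.funCongrLeft ℕ M finSumFinEquiv.symm).toAddEquiv⟩

/-- The groups `((((ℤ/q)^ℓ)^N)³)^{N'}` in which the tensor-power argument of BCCGNSU 2017, §3.2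
runs are `≅ (ℤ/q)^{3ℓNN'}` (as needed to feed Thm. A′). [folklore] -/
theorem nonempty_addEquiv_powers (ℓ N N' : ℕ) :
    Nonempty ((Fin N' → (Fin N → Fin ℓ → M) × (Fin N → Fin ℓ → M) × (Fin N → Fin ℓ → M)) ≃+
      (Fin (ℓ * (3 * N) * N') → M)) := by
  obtain ⟨e₁⟩ := nonempty_addEquiv_fun_fun M N ℓ
  obtain ⟨e₂⟩ := nonempty_addEquiv_fun_prod_fun M (N * ℓ) (N * ℓ)
  obtain ⟨e₃⟩ := nonempty_addEquiv_fun_prod_fun M (N * ℓ) (N * ℓ + N * ℓ)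
  obtain ⟨e₄⟩ := nonempty_addEquiv_fun_fun M N' (N * ℓ + (N * ℓ + N * ℓ))
  have e₅ : ((Fin N → Fin ℓ → M) × (Fin N → Fin ℓ → M) × (Fin N → Fin ℓ → M)) ≃+
      (Fin (N * ℓ + (N * ℓ + N * ℓ)) → M) :=
    ((e₁.prodCongr (e₁.prodCongr e₁)).trans ((AddEquiv.refl _).prodCongr e₂)).trans e₃
  have e₆ := (AddEquiv.piCongrRight fun _ : Fin N' => e₅).trans e₄
  have h : N' * (N * ℓ + (N * ℓ + N * ℓ)) = ℓ * (3 * N) * N' := by ring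
  exact ⟨e₆.trans (LinearEquiv.funCongrLeft ℕ M (finCongr h).symm).toAddEquiv⟩

end Flatten

/-! ### The key estimate: `Σᵢ (|Aᵢ||Bᵢ||Cᵢ|)^{2/3} ≤ (q e^{−δ})^ℓ` in `(ℤ/q)^ℓ` -/

section Key

/-- **The `2/3`-moment bound for STPP families in `(ℤ/q)^ℓ`, `q` a prime power** — the input
of the proof of Pratt's Thm. 4.4 ("`Σ (|Xᵢ||Yᵢ||Zᵢ|)^{2/3} ≤ (q/C^{1/3})^ℓ`"), obtained here NOT
from Pratt's Cor. 2.10 (false as printed: `Literature.Combinatorics.Additive.not_Pratt2024_cor210`)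
but from Blasiak–Church–Cohn–Grochow–Naslund–Sawin–Umans 2017: Thm. 3.3 (border tricolored
sum-free sets), Lemma 3.4, the type decomposition of Lemma 3.5 / §3.2 (the tree's
`AddSimultaneousTPP.card_fiber_pow_three_mul_sq_le`) and **Thm. A′ with its printed constant**
(`BCCGNSU2017_thmA'_holds`: tricolored sum-free sets in `(ℤ/q)ⁿ` have size `≤ 3 (q e^{−δ})ⁿ`,
`δ = log((2/3)2^{2/3})`), then `N → ∞`: every STPP family `(Aᵢ, Bᵢ, Cᵢ)ᵢ` in `(ℤ/q)^ℓ` has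
`Σᵢ (|Aᵢ||Bᵢ||Cᵢ|)^{2/3} ≤ (q e^{−δ})^ℓ` (so `C^{1/3} = e^{δ} = (4/3)2^{−1/3} ≈ 1.058`). This is
the proof of `AddSimultaneousTPP.exists_sum_rpow_le` (Thm. B) run with Thm. A′ in place of the
qualitative Thm. A. [cite: BlasiakChurchCohnGrochowNaslundSawinUmans2017, Thm. A′ and §3.2]
[cite: Pratt2024, Thm. 4.4 (proof, first display)] -/
theorem _root_.Literature.Combinatorics.Additive.AddSimultaneousTPP.sum_rpow_two_thirds_le_pow
    {q ℓ : ℕ} (hq : IsPrimePow q) {ι₀ : Type} [Fintype ι₀]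
    {A B C : ι₀ → Finset (Fin ℓ → ZMod q)} (hS : AddSimultaneousTPP A B C) :
    ∑ i, (((A i).card * (B i).card * (C i).card : ℕ) : ℝ) ^ ((2 : ℝ) / 3) ≤
      ((q : ℝ) * Real.exp (-bccgnsuDelta)) ^ ℓ := by
  classical
  haveI : NeZero q := ⟨hq.ne_zero⟩
  have hq0 : (0 : ℝ) < q := by exact_mod_cast hq.pos
  set m : ι₀ → ℕ := fun i => (A i).card * (B i).card * (C i).card with hm
  set Y : ℝ := ((q : ℝ) * Real.exp (-bccgnsuDelta)) ^ ℓ with hY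
  have hYpos : 0 < Y := by positivity
  set F : ℝ := ∑ i, ((m i : ℕ) : ℝ) ^ ((2 : ℝ) / 3) with hF
  suffices hclaim : ∀ N : ℕ, 1 ≤ N →
      F ^ N ≤ (3 : ℝ) ^ ((1 : ℝ) / 3) * ((N : ℝ) + 1) ^ Fintype.card ι₀ * Y ^ N from
    le_of_pow_le_poly_mul_pow hYpos hclaim
  intro N hN
  set K : ℝ := Y ^ (3 * N) with hK
  have hKpos : 0 < K := pow_pos hYpos _
  -- Thm. A′ in the powers of `((ℤ/q)^ℓ)^N)³ ≅ (ℤ/q)^{3ℓN}`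
  have hTSF : ∀ (N' : ℕ) (ι' : Type) [Fintype ι']
      (s t u : ι' → (Fin N' → (Fin N → Fin ℓ → ZMod q) × (Fin N → Fin ℓ → ZMod q) ×
        (Fin N → Fin ℓ → ZMod q))),
      IsTricoloredSumFree s t u → (Fintype.card ι' : ℝ) ≤ 3 * K ^ N' := by
    intro N' ι' _ s t u hT
    obtain ⟨e⟩ := nonempty_addEquiv_powers (ZMod q) ℓ N N'
    have h := BCCGNSU2017_thmA'.pow_form BCCGNSU2017_thmA'_holds hq _ e ι' s t u hT
    simpa only [hK, hY, pow_mul] using h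
  have htype_bound := fun τ => hS.card_fiber_pow_three_mul_sq_le N hKpos hTSF τ
  -- expand `F^N` over words (verbatim from the proof of Thm. B)
  have hFN : F ^ N =
      ∑ u : Fin N → ι₀, (((∏ i, m i ^ (wordType u i : ℕ) : ℕ) : ℝ)) ^ ((2 : ℝ) / 3) := by
    have h1 : F ^ N = ∏ _l : Fin N, F := by rw [Finset.prod_const, card_univ, Fintype.card_fin]
    rw [h1, hF, Fintype.prod_sum (fun (_ : Fin N) (i : ι₀) => ((m i : ℕ) : ℝ) ^ ((2 : ℝ) / 3))]
    refine Finset.sum_congr rfl fun u _ => ?_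
    rw [Real.finsetProd_rpow _ _ (fun l _ => by positivity), ← prod_eq_prod_pow_wordType m u]
    push_cast
    rfl
  rw [hFN, ← Finset.sum_fiberwise_of_maps_to (g := wordType) (t := univ) (fun u _ => mem_univ _)]
  have h3 : (0 : ℝ) ≤ (3 : ℝ) ^ ((1 : ℝ) / 3) * Y ^ N :=
    mul_nonneg (Real.rpow_nonneg (by norm_num) _) (pow_nonneg hYpos.le _)
  have hτ : ∀ τ : ι₀ → Fin (N + 1),
      ∑ u ∈ univ.filter (fun u => wordType u = τ),
        (((∏ i, m i ^ (wordType u i : ℕ) : ℕ) : ℝ)) ^ ((2 : ℝ) / 3) ≤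
          3 ^ ((1 : ℝ) / 3) * Y ^ N := by
    intro τ
    rw [Finset.sum_congr rfl fun u hu => (show (((∏ i, m i ^ (wordType u i : ℕ) : ℕ) : ℝ)) ^
      ((2 : ℝ) / 3) = (((∏ i, m i ^ (τ i : ℕ) : ℕ) : ℝ)) ^ ((2 : ℝ) / 3) by
        rw [(mem_filter.1 hu).2]), Finset.sum_const, nsmul_eq_mul]
    set T : ℝ := (((univ : Finset (Fin N → ι₀)).filter fun u => wordType u = τ).card : ℝ) with hT
    set P : ℝ := ((∏ i, m i ^ (τ i : ℕ) : ℕ) : ℝ) with hP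
    have hP0 : 0 ≤ P := Nat.cast_nonneg _
    have hb : T ^ 3 * P ^ 2 ≤ 3 * K := htype_bound τ
    refine le_of_pow_le_pow_left₀ three_ne_zero h3 ?_
    calc (T * P ^ ((2 : ℝ) / 3)) ^ 3 = T ^ 3 * P ^ 2 := by
          rw [mul_pow, ← Real.rpow_natCast (P ^ ((2 : ℝ) / 3)) 3, ← Real.rpow_mul hP0]
          norm_num
      _ ≤ 3 * K := hb
      _ = ((3 : ℝ) ^ ((1 : ℝ) / 3) * Y ^ N) ^ 3 := by
          rw [mul_pow, ← Real.rpow_natCast ((3 : ℝ) ^ ((1 : ℝ) / 3)) 3,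
            ← Real.rpow_mul (by norm_num : (0 : ℝ) ≤ 3), hK, ← pow_mul Y N 3, mul_comm N 3]
          norm_num
  calc ∑ τ : ι₀ → Fin (N + 1), ∑ u ∈ univ.filter (fun u => wordType u = τ),
        (((∏ i, m i ^ (wordType u i : ℕ) : ℕ) : ℝ)) ^ ((2 : ℝ) / 3)
      ≤ ∑ _τ : ι₀ → Fin (N + 1), (3 : ℝ) ^ ((1 : ℝ) / 3) * Y ^ N :=
        Finset.sum_le_sum fun τ _ => hτ τ
    _ = (3 : ℝ) ^ ((1 : ℝ) / 3) * ((N : ℝ) + 1) ^ Fintype.card ι₀ * Y ^ N := by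
        rw [Finset.sum_const, card_univ, nsmul_eq_mul, Fintype.card_fun, Fintype.card_fin]
        push_cast
        ring

end Key

/-! ### Hölder with exponents `1/α`, `1/(1−α)` (the second display of the proof of Thm. 4.4) -/

section Holder

/-- **The Hölder step of the proof of Pratt's Thm. 4.4** ("`Σ (|Xᵢ||Yᵢ||Zᵢ|)^{2α/3+(1−α)} =
Σ (…)^{2α/3} (…)^{1−α} ≤ (Σ (…)^{2/3})^α (Σ |Xᵢ||Yᵢ||Zᵢ|)^{1−α}`"), for nonnegative reals and
`0 < α < 1`. [cite: Pratt2024, Thm. 4.4 (proof)] -/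
theorem sum_rpow_le_rpow_mul_rpow_holder {ι : Type*} (s : Finset ι) (a : ι → ℝ)
    (ha : ∀ i, 0 ≤ a i) {α : ℝ} (hα0 : 0 < α) (hα1 : α < 1) :
    ∑ i ∈ s, a i ^ (2 * α / 3 + (1 - α)) ≤
      (∑ i ∈ s, a i ^ ((2 : ℝ) / 3)) ^ α * (∑ i ∈ s, a i) ^ (1 - α) := by
  have hpq := Real.HolderConjugate.inv_one_sub_inv hα0 hα1
  have h := Real.inner_le_Lp_mul_Lq_of_nonneg s (f := fun i => a i ^ (2 * α / 3))
    (g := fun i => a i ^ (1 - α)) hpq (fun i _ => Real.rpow_nonneg (ha i) _)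
    (fun i _ => Real.rpow_nonneg (ha i) _)
  have e1 : ∀ i ∈ s, a i ^ (2 * α / 3 + (1 - α)) = a i ^ (2 * α / 3) * a i ^ (1 - α) :=
    fun i _ => Real.rpow_add' (ha i) (by linarith)
  have e2 : ∀ i ∈ s, (a i ^ (2 * α / 3)) ^ α⁻¹ = a i ^ ((2 : ℝ) / 3) := by
    intro i _
    rw [← Real.rpow_mul (ha i)]
    congr 1
    field_simp
  have e3 : ∀ i ∈ s, (a i ^ (1 - α)) ^ (1 - α)⁻¹ = a i := by
    intro i _
    rw [← Real.rpow_mul (ha i), mul_inv_cancel₀ (by linarith), Real.rpow_one]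
  rw [Finset.sum_congr rfl e1]
  refine h.trans (le_of_eq ?_)
  rw [Finset.sum_congr rfl e2, Finset.sum_congr rfl e3, one_div, inv_inv, one_div, inv_inv]

/-- The Hölder step at `α = 33/34` (i.e. `ε = 1 − α = 1/34`, exponent `(2+ε)/3 = 23/34`), cleared
of fractional powers of the sums: `(Σ aᵢ^{23/34})³⁴ ≤ (Σ aᵢ^{2/3})³³ · Σ aᵢ`.
[cite: Pratt2024, Thm. 4.4 (proof)] -/
theorem pow_sum_rpow_le_holder {ι : Type*} (s : Finset ι) (a : ι → ℝ) (ha : ∀ i, 0 ≤ a i) :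
    (∑ i ∈ s, a i ^ ((23 : ℝ) / 34)) ^ 34 ≤
      (∑ i ∈ s, a i ^ ((2 : ℝ) / 3)) ^ 33 * ∑ i ∈ s, a i := by
  have h := sum_rpow_le_rpow_mul_rpow_holder s a ha (α := 33 / 34) (by norm_num) (by norm_num)
  have hexp : (2 * (33 / 34 : ℝ) / 3 + (1 - 33 / 34)) = (23 : ℝ) / 34 := by norm_num
  rw [hexp] at h
  have hF : 0 ≤ ∑ i ∈ s, a i ^ ((2 : ℝ) / 3) :=
    Finset.sum_nonneg fun i _ => Real.rpow_nonneg (ha i) _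
  have hS : 0 ≤ ∑ i ∈ s, a i := Finset.sum_nonneg fun i _ => ha i
  have hs : 0 ≤ ∑ i ∈ s, a i ^ ((23 : ℝ) / 34) :=
    Finset.sum_nonneg fun i _ => Real.rpow_nonneg (ha i) _
  calc (∑ i ∈ s, a i ^ ((23 : ℝ) / 34)) ^ 34
      ≤ ((∑ i ∈ s, a i ^ ((2 : ℝ) / 3)) ^ ((33 : ℝ) / 34) *
          (∑ i ∈ s, a i) ^ (1 - (33 : ℝ) / 34)) ^ 34 :=
        pow_le_pow_left₀ hs h 34
    _ = (∑ i ∈ s, a i ^ ((2 : ℝ) / 3)) ^ 33 * ∑ i ∈ s, a i := by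
        rw [mul_pow, ← Real.rpow_mul_natCast hF, ← Real.rpow_mul_natCast hS]
        norm_num

end Holder

/-! ### The numerical constant: `e^{33δ} > 3` -/

section Numeric

/-- `e^{33δ} = ((2/3)·2^{2/3})³³ = 2⁵⁵/3³³ > 3` (`2⁵⁵ = 36028797018963968 > 3³⁴ =
16677181699666569`): with `α = 33/34` the gain `C^{α/(1−α)} = e^{33δ}` per coordinate of the proof
of Thm. 4.4 beats the factor `3` lost in the embedding `ℤ_q^N ↪ ℤ_{(3q)^N}`.
[cite: Pratt2024, Thm. 4.4 (proof)] -/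
theorem three_lt_exp_mul_bccgnsuDelta : (3 : ℝ) < Real.exp (33 * bccgnsuDelta) := by
  have h2 : (0 : ℝ) < 2 / 3 * (2 : ℝ) ^ ((2 : ℝ) / 3) := by positivity
  rw [show (33 : ℝ) * bccgnsuDelta = ((33 : ℕ) : ℝ) * bccgnsuDelta by norm_num, Real.exp_nat_mul,
    bccgnsuDelta, Real.exp_log h2, mul_pow, ← Real.rpow_mul_natCast (by norm_num : (0 : ℝ) ≤ 2),
    show (2 : ℝ) / 3 * ((33 : ℕ) : ℝ) = ((22 : ℕ) : ℝ) by norm_num, Real.rpow_natCast]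
  norm_num

/-- Hence `3q ≤ q e^{33δ}` and `(3q)^ℓ ≤ (q e^{33δ})^ℓ`. [cite: Pratt2024, Thm. 4.4 (proof)] -/
theorem pow_three_mul_le_pow_mul_exp {q : ℝ} (hq : 0 ≤ q) (ℓ : ℕ) :
    (3 * q) ^ ℓ ≤ (q * Real.exp (33 * bccgnsuDelta)) ^ ℓ := by
  refine pow_le_pow_left₀ (by positivity) ?_ ℓ
  rw [mul_comm]
  exact mul_le_mul_of_nonneg_left three_lt_exp_mul_bccgnsuDelta.le hq

end Numeric

/-! ### From the `2/3`-moment bound and Hölder to a large family: `Σ|Xᵢ||Yᵢ||Zᵢ| > (3q)^ℓ` -/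

section Large

/-- **The gain of the proof of Pratt's Thm. 4.4, made effective**: if an STPP family in
`(ℤ/q)^ℓ` (`q` a prime power) certifies "`ω < 3 − α`" at `α = 33/34`, i.e.
`q^ℓ < Σᵢ (|Xᵢ||Yᵢ||Zᵢ|)^{23/34}` (`23/34 = 2α/3 + (1 − α)`), then `Σᵢ |Xᵢ||Yᵢ||Zᵢ| > (3q)^ℓ`.
Printed: "so `Val(G) > q^ℓ (C^{α/(3(1−α))})^ℓ`. By choosing `α` sufficiently close to `1`,
`Val(G) > q^ℓ 4^ℓ`" — here with the `2/3`-moment bound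
`AddSimultaneousTPP.sum_rpow_two_thirds_le_pow` (constant `e^{δ}` per coordinate) in
place of the refuted Cor. 2.10:
`q^{34ℓ} < (Σ a^{23/34})³⁴ ≤ (Σ a^{2/3})³³ Σ a ≤ (q e^{−δ})^{33ℓ} Σ a`, so
`Σ a > (q e^{33δ})^ℓ ≥ (3q)^ℓ`. [cite: Pratt2024, Thm. 4.4 (proof)] -/
theorem _root_.Literature.Combinatorics.Additive.AddSimultaneousTPP.pow_lt_sum_card_of_lt
    {q ℓ : ℕ} (hq : IsPrimePow q) {ι : Type} [Fintype ι] {X Y Z : ι → Finset (Fin ℓ → ZMod q)}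
    (hS : AddSimultaneousTPP X Y Z)
    (hlt : (q : ℝ) ^ ℓ < ∑ i, (((X i).card * (Y i).card * (Z i).card : ℕ) : ℝ) ^ ((23 : ℝ) / 34)) :
    ((3 * q : ℕ) : ℝ) ^ ℓ < ((∑ i, (X i).card * (Y i).card * (Z i).card : ℕ) : ℝ) := by
  have hq0 : (0 : ℝ) < q := by exact_mod_cast hq.pos
  set a : ι → ℝ := fun i => (((X i).card * (Y i).card * (Z i).card : ℕ) : ℝ) with ha
  have ha0 : ∀ i, 0 ≤ a i := fun i => Nat.cast_nonneg _
  have hF := hS.sum_rpow_two_thirds_le_pow hq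
  have hH := pow_sum_rpow_le_holder Finset.univ a ha0
  set F : ℝ := ∑ i, a i ^ ((2 : ℝ) / 3) with hFdef
  set Ycap : ℝ := ((q : ℝ) * Real.exp (-bccgnsuDelta)) ^ ℓ with hYcap
  set S : ℝ := ∑ i, a i with hSdef
  have hF0 : 0 ≤ F := Finset.sum_nonneg fun i _ => Real.rpow_nonneg (ha0 i) _
  have hS0 : 0 ≤ S := Finset.sum_nonneg fun i _ => ha0 i
  have hYpos : 0 < Ycap := by positivity
  -- `q^{34ℓ} < Ycap^33 · S`
  have h1 : ((q : ℝ) ^ ℓ) ^ 34 < Ycap ^ 33 * S :=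
    calc ((q : ℝ) ^ ℓ) ^ 34 < (∑ i, a i ^ ((23 : ℝ) / 34)) ^ 34 :=
          pow_lt_pow_left₀ hlt (by positivity) (by norm_num)
      _ ≤ F ^ 33 * S := hH
      _ ≤ Ycap ^ 33 * S := mul_le_mul_of_nonneg_right (pow_le_pow_left₀ hF0 hF 33) hS0
  -- `q^{34ℓ} = Ycap^33 · (q e^{33δ})^ℓ`
  have h2 : ((q : ℝ) ^ ℓ) ^ 34 = Ycap ^ 33 * ((q : ℝ) * Real.exp (33 * bccgnsuDelta)) ^ ℓ := by
    have key : (q : ℝ) ^ 34 =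
        ((q : ℝ) * Real.exp (-bccgnsuDelta)) ^ 33 * ((q : ℝ) * Real.exp (33 * bccgnsuDelta)) := by
      rw [mul_pow, mul_mul_mul_comm, ← pow_succ, ← Real.exp_nat_mul, ← Real.exp_add]
      norm_num
    rw [hYcap, ← pow_mul ((q : ℝ) * Real.exp (-bccgnsuDelta)) ℓ 33, mul_comm ℓ 33,
      pow_mul ((q : ℝ) * Real.exp (-bccgnsuDelta)) 33 ℓ, ← mul_pow, ← key, ← pow_mul, ← pow_mul,
      mul_comm ℓ 34]
  rw [h2] at h1
  have h3 : ((q : ℝ) * Real.exp (33 * bccgnsuDelta)) ^ ℓ < S :=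
    lt_of_mul_lt_mul_left h1 (pow_nonneg hYpos.le 33)
  have h4 := pow_three_mul_le_pow_mul_exp hq0.le ℓ
  have hS' : S = ((∑ i, (X i).card * (Y i).card * (Z i).card : ℕ) : ℝ) := by
    rw [hSdef, ha]; push_cast; rfl
  rw [← hS']
  push_cast
  exact h4.trans_lt h3

end Large

/-! ### Powers of the family, transport to `ℤ/nℤ`, and interpolation over all `n` -/

section Transfer

/-- The `k`-th power of a family (boxes `∏ₗ A_{I l}` in `H^k`, indexed by words `I ∈ ι^k`) has
`Σ_I |A_I||B_I||C_I| = (Σᵢ |Aᵢ||Bᵢ||Cᵢ|)^k` ("by taking `k`-fold products of the sets defining the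
STPP constructions"). [cite: Pratt2024, Thm. 4.4 (proof)] -/
theorem sum_card_piFinset_eq_pow {H : Type*} {ι : Type*} [Fintype ι] (A B C : ι → Finset H)
    (k : ℕ) :
    ∑ I : Fin k → ι, (Fintype.piFinset fun l => A (I l)).card *
        (Fintype.piFinset fun l => B (I l)).card * (Fintype.piFinset fun l => C (I l)).card =
      (∑ i, (A i).card * (B i).card * (C i).card) ^ k := by
  simp only [Fintype.card_piFinset, ← Finset.prod_mul_distrib]
  rw [show (∑ i, (A i).card * (B i).card * (C i).card) ^ k =
      ∏ _l : Fin k, ∑ i, (A i).card * (B i).card * (C i).card by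
        rw [Finset.prod_const, card_univ, Fintype.card_fin],
    Fintype.prod_sum (fun (_ : Fin k) (i : ι) => (A i).card * (B i).card * (C i).card)]

/-- **Powers and the mixed-radix transport** ("we find … `Val(ℤ_q^{kℓ}) > (4q)^{kℓ}` for all `k`
… Hence the image of an STPP under `φ` is an STPP inside of `ℤ_{(3q)^N}`, so
`Val(ℤ_{(3q)^N}) > (4q)^N`"): for an STPP family in `(ℤ/q)^ℓ` with `S = Σᵢ |Xᵢ||Yᵢ||Zᵢ|`, every
`k` and every modulus `n ≥ (3q)^{kℓ}` (not only `n = (3q)^{kℓ}`: the mixed-radix map has all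
three-fold sums below `(3q)^{kℓ}`), `S^k ≤ Val(ℤ/nℤ)` — the `k`-th power family is STPP in
`((ℤ/q)^ℓ)^k ≅ (ℤ/q)^{kℓ}` (`AddSimultaneousTPP.pi`) and is transported by
`sum_card_mul_le_prattVal_zmod_of_reflect` (Prop. 3.3 included).
[cite: Pratt2024, Thm. 4.4 (proof)] -/
theorem _root_.Literature.Combinatorics.Additive.AddSimultaneousTPP.pow_sum_card_le_prattVal
    {q ℓ : ℕ} (hq : 0 < q) {ι : Type*} [Fintype ι] {X Y Z : ι → Finset (Fin ℓ → ZMod q)}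
    (hS : AddSimultaneousTPP X Y Z) (k : ℕ) {n : ℕ} [NeZero n] (hn : (3 * q) ^ (k * ℓ) ≤ n) :
    (∑ i, (X i).card * (Y i).card * (Z i).card) ^ k ≤ prattVal (ZMod n) := by
  classical
  obtain ⟨e⟩ := nonempty_addEquiv_fun_fun (ZMod q) k ℓ
  obtain ⟨ψ, h1, h2⟩ := exists_freiman3_of_addEquiv (K := Fin k → Fin ℓ → ZMod q)
    (m := fun _ : Fin (k * ℓ) => q) (fun _ => hq) e
  have hbound : 3 ^ (k * ℓ) * ∏ _i : Fin (k * ℓ), q = (3 * q) ^ (k * ℓ) := by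
    rw [Finset.prod_const, card_univ, Fintype.card_fin, mul_pow]
  rw [hbound] at h1
  rw [← sum_card_piFinset_eq_pow X Y Z k]
  exact sum_card_mul_le_prattVal_zmod_of_reflect (hS.pi (κ := Fin k))
    (fun a b c => (h1 a b c).trans_le hn) h2

/-- **Interpolation over all moduli** (in place of Pratt's Prop. 4.3 (3), which the tree does not
carry: the transport works for every `n ≥ (3q)^{kℓ}` directly): if `B ≥ 2`, `B < S` and
`S^k ≤ Val(ℤ/nℤ)` whenever `B^k ≤ n`, then with `c = log S / log B − 1 > 0` (so `B^{1+c} = S`)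
and `K = 1/S`, for every `n ≥ 1`, taking `k = ⌊log_B n⌋`:
`K n^{1+c} < K B^{(k+1)(1+c)} = S^k ≤ Val(ℤ/nℤ)`. [folklore] -/
theorem exists_const_rpow_le_prattVal {B S : ℕ} (hB : 2 ≤ B) (hBS : B < S)
    (h : ∀ (k n : ℕ) (_ : NeZero n), B ^ k ≤ n → S ^ k ≤ prattVal (ZMod n)) :
    ∃ c : ℝ, 0 < c ∧ ∃ K : ℝ, 0 < K ∧ ∀ (n : ℕ) (_ : NeZero n),
      K * (n : ℝ) ^ (1 + c) ≤ (prattVal (ZMod n) : ℝ) := by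
  have hB1 : (1 : ℝ) < B := by exact_mod_cast (show 1 < B by omega)
  have hB0 : (0 : ℝ) < B := zero_lt_one.trans hB1
  have hS1 : (1 : ℝ) < S := by exact_mod_cast (show 1 < S by omega)
  have hS0 : (0 : ℝ) < S := zero_lt_one.trans hS1
  have hBS' : (B : ℝ) < S := by exact_mod_cast hBS
  have hlogB : 0 < Real.log B := Real.log_pos hB1
  have hlogS : Real.log B < Real.log S := Real.log_lt_log hB0 hBS'
  set c : ℝ := Real.log S / Real.log B - 1 with hc
  have hc0 : 0 < c := by
    rw [hc, sub_pos, lt_div_iff₀ hlogB, one_mul]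
    exact hlogS
  have hBc : (B : ℝ) ^ (1 + c) = S := by
    rw [Real.rpow_def_of_pos hB0, hc]
    have : Real.log B * (1 + (Real.log S / Real.log B - 1)) = Real.log S := by
      field_simp
      ring
    rw [this, Real.exp_log hS0]
  refine ⟨c, hc0, 1 / S, by positivity, fun n hn => ?_⟩
  have hn0 : n ≠ 0 := hn.out
  set k := Nat.log B n with hk
  have hk1 : B ^ k ≤ n := Nat.pow_log_le_self B hn0
  have hk2 : n < B ^ (k + 1) := Nat.lt_pow_succ_log_self (by omega) n
  have hval : ((S ^ k : ℕ) : ℝ) ≤ prattVal (ZMod n) := by exact_mod_cast h k n hn hk1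
  have hnk : (n : ℝ) ^ (1 + c) < (S : ℝ) ^ (k + 1) := by
    calc (n : ℝ) ^ (1 + c) < ((B ^ (k + 1) : ℕ) : ℝ) ^ (1 + c) :=
          Real.rpow_lt_rpow (Nat.cast_nonneg n) (by exact_mod_cast hk2) (by linarith)
      _ = ((B : ℝ) ^ (1 + c)) ^ (k + 1) := by
          push_cast
          rw [← Real.rpow_natCast ((B : ℝ)) (k + 1), ← Real.rpow_mul hB0.le, mul_comm,
            Real.rpow_mul hB0.le, Real.rpow_natCast]
      _ = (S : ℝ) ^ (k + 1) := by rw [hBc]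
  have : 1 / (S : ℝ) * (n : ℝ) ^ (1 + c) ≤ ((S ^ k : ℕ) : ℝ) := by
    rw [one_div, inv_mul_le_iff₀ hS0]
    push_cast
    rw [← pow_succ']
    exact hnk.le
  exact this.trans hval

end Transfer

/-! ### Theorem 4.4 -/

section Main

/-- **Pratt 2024, Theorem 4.4, PROVED** (`pratt2024_thm44`: if STPP constructions in the groups
`(ℤ/q)^ℓ`, `q` a prime power, achieve `ω = 2` — for every `ε > 0` some family has
`q^ℓ < Σᵢ (|Xᵢ||Yᵢ||Zᵢ|)^{(2+ε)/3}` — then `Val(ℤ/nℤ) ≥ K n^{1+c}` for some `c, K > 0` and all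
`n ≥ 1`). Proof, following the printed one (p. 9) except for its first line: (i) the `2/3`-moment
bound `Σᵢ (|Xᵢ||Yᵢ||Zᵢ|)^{2/3} ≤ (q e^{−δ})^ℓ`
(`AddSimultaneousTPP.sum_rpow_two_thirds_le_pow`, from BCCGNSU 2017 Thm. A′ / §3.2 —
the printed source of this bound, Cor. 2.10, is false as stated,
`Literature.Combinatorics.Additive.not_Pratt2024_cor210`); (ii) the hypothesis at `ε = 1/34`
(`α = 33/34`) and Hölder give a family with `S = Σ|Xᵢ||Yᵢ||Zᵢ| > (q e^{33δ})^ℓ ≥ (3q)^ℓ`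
(`AddSimultaneousTPP.pow_lt_sum_card_of_lt`; `e^{33δ} > 3`); (iii) `k`-fold products of the family
are STPP in `(ℤ/q)^{kℓ}` with `Σ = S^k`, and the mixed-radix map `ℤ_q^{kℓ} → ℤ_n`, `n ≥ (3q)^{kℓ}`,
reflects three-fold sums, so `S^k ≤ Val(ℤ/nℤ)` by Prop. 3.3
(`AddSimultaneousTPP.pow_sum_card_le_prattVal`); (iv) for arbitrary `n ≥ 1` take the largest such
`k` (`exists_const_rpow_le_prattVal`, replacing Prop. 4.3 (3)): `Val(ℤ/nℤ) ≥ S^k > n^{1+c}/S`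
with `(3q)^{ℓ(1+c)} = S`. (`ℓ = 0` cannot occur: it would give `S^k ≤ Val(ℤ/1ℤ)` for all `k`
with `S ≥ 2`.) [cite: Pratt2024, Thm. 4.4]
[cite: BlasiakChurchCohnGrochowNaslundSawinUmans2017, Thm. A′ and §3.2] -/
theorem pratt2024_thm44_holds : pratt2024_thm44 := by
  intro hyp
  obtain ⟨q, ℓ, hq, ι, hι, X, Y, Z, hS, hlt⟩ := hyp (1 / 34) (by norm_num)
  have hexp : (2 + 1 / 34) / 3 = (23 : ℝ) / 34 := by norm_num
  rw [hexp] at hlt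
  have hlarge := hS.pow_lt_sum_card_of_lt hq hlt
  set S : ℕ := ∑ i, (X i).card * (Y i).card * (Z i).card with hSdef
  set B : ℕ := (3 * q) ^ ℓ with hBdef
  have hBS : B < S := by
    have : ((B : ℕ) : ℝ) < S := by rw [hBdef]; exact_mod_cast hlarge
    exact_mod_cast this
  have htrans : ∀ (k n : ℕ) (_ : NeZero n), B ^ k ≤ n → S ^ k ≤ prattVal (ZMod n) := by
    intro k n hn hkn
    refine hS.pow_sum_card_le_prattVal hq.pos k ?_
    rw [mul_comm k ℓ, pow_mul]
    exact hkn
  have hq3 : 2 ≤ 3 * q := by have := hq.one_lt; omega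
  rcases Nat.eq_zero_or_pos ℓ with hℓ | hℓ
  · -- `ℓ = 0`: `B = 1`, so `S^k ≤ Val(ℤ/1ℤ)` for all `k` with `S ≥ 2` — impossible
    exfalso
    have hB1 : B = 1 := by rw [hBdef, hℓ, pow_zero]
    have hS2 : 2 ≤ S := by omega
    have hk := htrans (prattVal (ZMod 1)) 1 inferInstance (by rw [hB1, one_pow])
    have hlt2 : prattVal (ZMod 1) < 2 ^ prattVal (ZMod 1) := Nat.lt_two_pow_self
    have hle2 : 2 ^ prattVal (ZMod 1) ≤ S ^ prattVal (ZMod 1) := Nat.pow_le_pow_left hS2 _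
    omega
  · have hB2 : 2 ≤ B := by
      rw [hBdef]
      calc 2 ≤ 3 * q := hq3
        _ = (3 * q) ^ 1 := (pow_one _).symm
        _ ≤ (3 * q) ^ ℓ := Nat.pow_le_pow_right (by omega) hℓ
    exact exists_const_rpow_le_prattVal hB2 hBS htrans

end Main

end Literature.Computability.AlgebraicComplexity

end
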